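import Mathlib
import Summits.ValiantsHypothesis.ValiantsHypothesis.Theses.NewtonUnitEquations
import Summits.ValiantsHypothesis.ValiantsHypothesis.Theorems.NewtonUnitEquationsTwoProductsExposure
import Summits.ValiantsHypothesis.ValiantsHypothesis.Theorems.NewtonUnitEquationsTwoProductsSweep
import Summits.ValiantsHypothesis.ValiantsHypothesis.Theorems.NewtonUnitEquationsTwoProductsSectorCover
import Summits.ValiantsHypothesis.ValiantsHypothesis.Theorems.NewtonUnitEquationsTwoProductsConeChart
import Summits.ValiantsHypothesis.ValiantsHypothesis.Theorems.NewtonUnitEquationsTwoProductsPowerSumCriterion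
import Summits.ValiantsHypothesis.ValiantsHypothesis.Theorems.NewtonUnitEquationsTwoProductsRaySeries
import Summits.ValiantsHypothesis.ValiantsHypothesis.Theorems.NewtonUnitEquationsTwoProductsEquivalence


/-!
# `TwoProducts` (stmt-ValiantsHypothesis-5906): reduction of the crux to the local log-sum count; the binomial case

Line `corner-log-linearization` (lead seat), assembled from the six landed stubs
`NewtonUnitEquationsTwoProducts{Exposure,Sweep,SectorCover,ConeChart,PowerSumCriterion,RaySeries}.lean`:
`vertBound` (local south-west bound `N` ⇒ `≤ (8mt²+4)(N+2)` combinatorial vertices of `∏f − ∏g`; zero factors by the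
doubling trick), `twoProducts_of_logSumNewton` (the crux from the registered open stub `stub_logSumNewton`, constants
`(a+2, b+8)`), `twoProducts_sparsity_le_two` (UNCONDITIONAL: factors with `≤ 2` monomials, any `m`, all regimes ⇒
`≤ 72(m+1)²` vertices; contains route item `BinomialPencil`).  Definition-free: the line's objects (`wt`, `IsStrictMin`,
`vertSet`, `swVertSet`, `logPowerSum`, `logVertSet`, `Adapted`, `sectSet`) are inlined over Mathlib. [folklore]
-/

set_option linter.dupNamespace false -- single-conjunct summit: `ValiantsHypothesis.ValiantsHypothesis`

namespace Summit.ValiantsHypothesis.ValiantsHypothesis.Theorems.TwoProducts.Reduction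

open scoped BigOperators Classical

noncomputable section

variable {m : ℕ}

/-! ## Local bounds (the identification `swVertSet = logVertSet` is `Equivalence.swVert_eq_logVert`) -/

/-- LOCAL BOUND for binomial instances (`t ≤ 2`), unconditionally: `#swVertSet(∏u − ∏v) ≤ 2n` (ray series). [folklore] -/
theorem local_bound_two {n t : ℕ} (ht : t ≤ 2) (u v : Fin n → MvPolynomial (Fin 2) ℂ)
    (hut : ∀ i, (u i).support.card ≤ t) (hvt : ∀ i, (v i).support.card ≤ t)
    (hu : ∀ i, MvPolynomial.coeff 0 (u i) = 1) (hv : ∀ i, MvPolynomial.coeff 0 (v i) = 1) :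
    ({e : Fin 2 →₀ ℕ | ∃ w : Fin 2 → ℤ, 0 < w 0 ∧ 0 < w 1 ∧ ((e) ∈ ((∏ i, u i - ∏ i, v i).support) ∧ ∀ e' ∈ ((∏ i, u i - ∏ i, v i).support), e' ≠ (e) → ((w) 0 * ((e) 0 : ℤ) + (w) 1 * ((e) 1 : ℤ)) < ((w) 0 * ((e') 0 : ℤ) + (w) 1 * ((e') 1 :
          ℤ)))}).ncard ≤ 2 * n := by
  rw [Summit.ValiantsHypothesis.ValiantsHypothesis.Theorems.TwoProducts.Equivalence.swVert_eq_logVert u v hu hv]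
  exact Summit.ValiantsHypothesis.ValiantsHypothesis.Theorems.TwoProducts.RaySeries.stub_raySeries n u v
    (fun i => (hut i).trans ht) (fun i => (hvt i).trans ht) hu hv

/-- LOCAL BOUND from a log-sum Newton bound with constants `(a, b)` for `t ≥ 3`: every local instance satisfies the
south-west bound with constants `(a+1, b)`. [folklore] -/
theorem local_bound_of_logSum {a b : ℕ}
    (hLog : ∀ (n t : ℕ) (u v : Fin n → MvPolynomial (Fin 2) ℂ), 3 ≤ t →
      (∀ i, (u i).support.card ≤ t) → (∀ i, (v i).support.card ≤ t) →
      (∀ i, MvPolynomial.coeff 0 (u i) = 1) → (∀ i, MvPolynomial.coeff 0 (v i) = 1) →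
      ({e : Fin 2 →₀ ℕ | ∃ w : Fin 2 → ℤ, 0 < w 0 ∧ 0 < w 1 ∧ ∀ R : ℕ, ((w) 0 * ((e) 0 : ℤ) + (w) 1 * ((e) 1 : ℤ)) < (R : ℤ) → ((e) ∈ ((∑ r ∈ Finset.Icc 1 R, ((-1 : ℂ) ^ (r + 1) / (r : ℂ)) • (∑ i, (u i - 1) ^ r - ∑ i, (v i - 1) ^
            r)).support) ∧ ∀ e' ∈ ((∑ r ∈ Finset.Icc 1 R, ((-1 : ℂ) ^ (r + 1) / (r : ℂ)) • (∑ i, (u i - 1) ^ r - ∑ i, (v i - 1) ^ r)).support), e' ≠ (e) → ((w) 0 * ((e) 0 : ℤ) + (w) 1 * ((e) 1 : ℤ)) < ((w) 0 * ((e') 0 : ℤ) + (w) 1 * ((e')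
            1 : ℤ)))}).ncard ≤ 2 ^ (a * n) * (t + 2) ^ b)
    {n t : ℕ} (u v : Fin n → MvPolynomial (Fin 2) ℂ)
    (hut : ∀ i, (u i).support.card ≤ t) (hvt : ∀ i, (v i).support.card ≤ t)
    (hu : ∀ i, MvPolynomial.coeff 0 (u i) = 1) (hv : ∀ i, MvPolynomial.coeff 0 (v i) = 1) :
    ({e : Fin 2 →₀ ℕ | ∃ w : Fin 2 → ℤ, 0 < w 0 ∧ 0 < w 1 ∧ ((e) ∈ ((∏ i, u i - ∏ i, v i).support) ∧ ∀ e' ∈ ((∏ i, u i - ∏ i, v i).support), e' ≠ (e) → ((w) 0 * ((e) 0 : ℤ) + (w) 1 * ((e) 1 : ℤ)) < ((w) 0 * ((e') 0 : ℤ) + (w) 1 * ((e') 1 :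
          ℤ)))}).ncard ≤ 2 ^ ((a + 1) * n) * (t + 2) ^ b := by
  by_cases ht : t ≤ 2
  · have h2n : 2 * n ≤ 2 ^ n := by
      rcases Nat.eq_zero_or_pos n with hn | hn
      · subst hn; simp
      · have h := Nat.lt_two_pow_self (n := n - 1)
        calc 2 * n = 2 * (n - 1 + 1) := by rw [Nat.sub_add_cancel hn]
          _ ≤ 2 * 2 ^ (n - 1) := by omega
          _ = 2 ^ (n - 1 + 1) := by rw [pow_succ]; ring
          _ = 2 ^ n := by rw [Nat.sub_add_cancel hn]
    calc _ ≤ 2 * n := local_bound_two ht u v hut hvt hu hv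
      _ ≤ 2 ^ n := h2n
      _ = 2 ^ (1 * n) * (t + 2) ^ 0 := by ring
      _ ≤ 2 ^ ((a + 1) * n) * (t + 2) ^ b := Nat.mul_le_mul
          (Nat.pow_le_pow_right (by norm_num) (Nat.mul_le_mul_right n (by omega)))
          (Nat.one_le_pow _ _ (by omega))
  · rw [Summit.ValiantsHypothesis.ValiantsHypothesis.Theorems.TwoProducts.Equivalence.swVert_eq_logVert u v hu hv]
    calc _ ≤ 2 ^ (a * n) * (t + 2) ^ b := hLog n t u v (by omega) hut hvt hu hv
      _ ≤ 2 ^ ((a + 1) * n) * (t + 2) ^ b :=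
          Nat.mul_le_mul_right _ (Nat.pow_le_pow_right (by norm_num) (Nat.mul_le_mul_right n (by omega)))

/-! ## From a local bound to the global combinatorial vertex bound -/

/-- PER-SECTOR BOUND (cone chart): with a local bound `N` at sparsity `t`, every adapted sector datum of `t`-sparse
families has at most `N + 2` sector vertices. [folklore] -/
theorem sect_bound {N t : ℕ} (f g : Fin m → MvPolynomial (Fin 2) ℂ)
    (hf : ∀ j, (f j).support.card ≤ t) (hg : ∀ j, (g j).support.card ≤ t)
    (hloc : ∀ (u v : Fin m → MvPolynomial (Fin 2) ℂ),
      (∀ i, (u i).support.card ≤ t) → (∀ i, (v i).support.card ≤ t) →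
      (∀ i, MvPolynomial.coeff 0 (u i) = 1) → (∀ i, MvPolynomial.coeff 0 (v i) = 1) →
      ({e : Fin 2 →₀ ℕ | ∃ w : Fin 2 → ℤ, 0 < w 0 ∧ 0 < w 1 ∧ ((e) ∈ ((∏ i, u i - ∏ i, v i).support) ∧ ∀ e' ∈ ((∏ i, u i - ∏ i, v i).support), e' ≠ (e) → ((w) 0 * ((e) 0 : ℤ) + (w) 1 * ((e) 1 : ℤ)) < ((w) 0 * ((e') 0 : ℤ) + (w) 1 * ((e') 1
            : ℤ)))}).ncard ≤ N)
    (μ ν : Fin m → (Fin 2 →₀ ℕ)) (r₁ r₂ : Fin 2 → ℤ) (hA : ((r₁) 0 * (r₂) 1 ≠ (r₁) 1 * (r₂) 0 ∧ (∀ j, ∀ p ∈ (f j).support, ((r₁) 0 * ((μ j) 0 : ℤ) + (r₁) 1 * ((μ j) 1 : ℤ)) ≤ ((r₁) 0 * ((p) 0 : ℤ) + (r₁) 1 * ((p) 1 : ℤ)) ∧ ((r₂) 0 * ((μ j)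
          0 : ℤ) + (r₂) 1 * ((μ j) 1 : ℤ)) ≤ ((r₂) 0 * ((p) 0 : ℤ) + (r₂) 1 * ((p) 1 : ℤ))) ∧ (∀ j, ∀ p ∈ (g j).support, ((r₁) 0 * ((ν j) 0 : ℤ) + (r₁) 1 * ((ν j) 1 : ℤ)) ≤ ((r₁) 0 * ((p) 0 : ℤ) + (r₁) 1 * ((p) 1 : ℤ)) ∧ ((r₂) 0 * ((ν j) 0
          : ℤ) + (r₂) 1 * ((ν j) 1 : ℤ)) ≤ ((r₂) 0 * ((p) 0 : ℤ) + (r₂) 1 * ((p) 1 : ℤ))))) :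
    ({e : Fin 2 →₀ ℕ | ∃ a b : ℤ, 0 < a ∧ 0 < b ∧ (∀ j, ((μ j) ∈ ((f j).support) ∧ ∀ e' ∈ ((f j).support), e' ≠ (μ j) → ((a • (r₁) + b • (r₂)) 0 * ((μ j) 0 : ℤ) + (a • (r₁) + b • (r₂)) 1 * ((μ j) 1 : ℤ)) < ((a • (r₁) + b • (r₂)) 0 * ((e')
          0 : ℤ) + (a • (r₁) + b • (r₂)) 1 * ((e') 1 : ℤ)))) ∧ (∀ j, ((ν j) ∈ ((g j).support) ∧ ∀ e' ∈ ((g j).support), e' ≠ (ν j) → ((a • (r₁) + b • (r₂)) 0 * ((ν j) 0 : ℤ) + (a • (r₁) + b • (r₂)) 1 * ((ν j) 1 : ℤ)) < ((a • (r₁) + b •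
          (r₂)) 0 * ((e') 0 : ℤ) + (a • (r₁) + b • (r₂)) 1 * ((e') 1 : ℤ)))) ∧ ((e) ∈ ((∏ j, f j - ∏ j, g j).support) ∧ ∀ e' ∈ ((∏ j, f j - ∏ j, g j).support), e' ≠ (e) → ((a • (r₁) + b • (r₂)) 0 * ((e) 0 : ℤ) + (a • (r₁) + b • (r₂)) 1 *
          ((e) 1 : ℤ)) < ((a • (r₁) + b • (r₂)) 0 * ((e') 0 : ℤ) + (a • (r₁) + b • (r₂)) 1 * ((e') 1 : ℤ)))}).ncard ≤ N + 2 := by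
  rcases ({e : Fin 2 →₀ ℕ | ∃ a b : ℤ, 0 < a ∧ 0 < b ∧ (∀ j, ((μ j) ∈ ((f j).support) ∧ ∀ e' ∈ ((f j).support), e' ≠ (μ j) → ((a • (r₁) + b • (r₂)) 0 * ((μ j) 0 : ℤ) + (a • (r₁) + b • (r₂)) 1 * ((μ j) 1 : ℤ)) < ((a • (r₁) + b • (r₂)) 0 *
        ((e') 0 : ℤ) + (a • (r₁) + b • (r₂)) 1 * ((e') 1 : ℤ)))) ∧ (∀ j, ((ν j) ∈ ((g j).support) ∧ ∀ e' ∈ ((g j).support), e' ≠ (ν j) → ((a • (r₁) + b • (r₂)) 0 * ((ν j) 0 : ℤ) + (a • (r₁) + b • (r₂)) 1 * ((ν j) 1 : ℤ)) < ((a • (r₁) + b •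
        (r₂)) 0 * ((e') 0 : ℤ) + (a • (r₁) + b • (r₂)) 1 * ((e') 1 : ℤ)))) ∧ ((e) ∈ ((∏ j, f j - ∏ j, g j).support) ∧ ∀ e' ∈ ((∏ j, f j - ∏ j, g j).support), e' ≠ (e) → ((a • (r₁) + b • (r₂)) 0 * ((e) 0 : ℤ) + (a • (r₁) + b • (r₂)) 1 *
        ((e) 1 : ℤ)) < ((a • (r₁) + b • (r₂)) 0 * ((e') 0 : ℤ) + (a • (r₁) + b • (r₂)) 1 * ((e') 1 : ℤ)))}).eq_empty_or_nonempty with h0 | hne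
  · rw [h0, Set.ncard_empty]; exact Nat.zero_le _
  · obtain ⟨u, v, hu, hv, hu1, hv1, hle⟩ :=
      Summit.ValiantsHypothesis.ValiantsHypothesis.Theorems.TwoProducts.ConeChart.stub_coneChart m t f g hf hg
        μ ν r₁ r₂ hA hne
    exact hle.trans (Nat.add_le_add_right (hloc u v hu hv hu1 hv1) 2)

/-- The difference of weights is the weight of the integer difference vector. [folklore] -/
theorem wt_sub (w : Fin 2 → ℤ) (p q : Fin 2 →₀ ℕ) :
    (w 0 * (p 0 : ℤ) + w 1 * (p 1 : ℤ)) - (w 0 * (q 0 : ℤ) + w 1 * (q 1 : ℤ)) =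
      w 0 * ((p 0 : ℤ) - (q 0 : ℤ)) + w 1 * ((p 1 : ℤ) - (q 1 : ℤ)) := by ring

/-- NONZERO FACTORS: `#vertSet(∏f − ∏g) ≤ (8mt² + 4)·(N + 2)` from the sweep, the sector cover and the cone chart. [folklore] -/
theorem vertBound_nonzero {N t : ℕ} (f g : Fin m → MvPolynomial (Fin 2) ℂ)
    (hf : ∀ j, (f j).support.card ≤ t) (hg : ∀ j, (g j).support.card ≤ t)
    (hf0 : ∀ j, f j ≠ 0) (hg0 : ∀ j, g j ≠ 0)
    (hloc : ∀ (u v : Fin m → MvPolynomial (Fin 2) ℂ),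
      (∀ i, (u i).support.card ≤ t) → (∀ i, (v i).support.card ≤ t) →
      (∀ i, MvPolynomial.coeff 0 (u i) = 1) → (∀ i, MvPolynomial.coeff 0 (v i) = 1) →
      ({e : Fin 2 →₀ ℕ | ∃ w : Fin 2 → ℤ, 0 < w 0 ∧ 0 < w 1 ∧ ((e) ∈ ((∏ i, u i - ∏ i, v i).support) ∧ ∀ e' ∈ ((∏ i, u i - ∏ i, v i).support), e' ≠ (e) → ((w) 0 * ((e) 0 : ℤ) + (w) 1 * ((e) 1 : ℤ)) < ((w) 0 * ((e') 0 : ℤ) + (w) 1 * ((e') 1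
            : ℤ)))}).ncard ≤ N) :
    ({e : Fin 2 →₀ ℕ | ∃ w : Fin 2 → ℤ, ((e) ∈ ((∏ j, f j - ∏ j, g j).support) ∧ ∀ e' ∈ ((∏ j, f j - ∏ j, g j).support), e' ≠ (e) → ((w) 0 * ((e) 0 : ℤ) + (w) 1 * ((e) 1 : ℤ)) < ((w) 0 * ((e') 0 : ℤ) + (w) 1 * ((e') 1 : ℤ)))}).ncard ≤ (8 *
          m * t ^ 2 + 4) * (N + 2) := by
  -- the within-factor difference vectors (ordered pairs of distinct support points, both families)
  set dv : (Fin 2 →₀ ℕ) × (Fin 2 →₀ ℕ) → (Fin 2 → ℤ) := fun pq i => (pq.1 i : ℤ) - (pq.2 i : ℤ) with hdv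
  set D : Finset (Fin 2 → ℤ) :=
    (Finset.univ.biUnion fun j => (f j).support.offDiag.image dv) ∪
    (Finset.univ.biUnion fun j => (g j).support.offDiag.image dv) with hD
  have hDcard : D.card ≤ 2 * m * t ^ 2 := by
    have h1 : ∀ (h : Fin m → MvPolynomial (Fin 2) ℂ), (∀ j, (h j).support.card ≤ t) →
        (Finset.univ.biUnion fun j => (h j).support.offDiag.image dv).card ≤ m * t ^ 2 := by
      intro h hh
      calc _ ≤ ∑ j : Fin m, ((h j).support.offDiag.image dv).card := Finset.card_biUnion_le
        _ ≤ ∑ _j : Fin m, t ^ 2 := Finset.sum_le_sum fun j _ => by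
            calc _ ≤ (h j).support.offDiag.card := Finset.card_image_le
              _ = (h j).support.card * (h j).support.card - (h j).support.card := Finset.offDiag_card _
              _ ≤ (h j).support.card * (h j).support.card := Nat.sub_le _ _
              _ ≤ t * t := Nat.mul_le_mul (hh j) (hh j)
              _ = t ^ 2 := (sq t).symm
        _ = m * t ^ 2 := by simp
    calc D.card ≤ _ + _ := Finset.card_union_le _ _
      _ ≤ m * t ^ 2 + m * t ^ 2 := Nat.add_le_add (h1 f hf) (h1 g hg)
      _ = 2 * m * t ^ 2 := by ring
  have hmemf : ∀ j p q, p ∈ (f j).support → q ∈ (f j).support → p ≠ q → dv (p, q) ∈ D := fun j p q hp hq hpq =>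
    Finset.mem_union_left _ (Finset.mem_biUnion.2 ⟨j, Finset.mem_univ _,
      Finset.mem_image.2 ⟨(p, q), Finset.mem_offDiag.2 ⟨hp, hq, hpq⟩, rfl⟩⟩)
  have hmemg : ∀ j p q, p ∈ (g j).support → q ∈ (g j).support → p ≠ q → dv (p, q) ∈ D := fun j p q hp hq hpq =>
    Finset.mem_union_right _ (Finset.mem_biUnion.2 ⟨j, Finset.mem_univ _,
      Finset.mem_image.2 ⟨(p, q), Finset.mem_offDiag.2 ⟨hp, hq, hpq⟩, rfl⟩⟩)
  have hdv0 : ∀ p q : Fin 2 →₀ ℕ, dv (p, q) 0 = (p 0 : ℤ) - (q 0 : ℤ) := fun p q => rfl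
  have hdv1 : ∀ p q : Fin 2 →₀ ℕ, dv (p, q) 1 = (p 1 : ℤ) - (q 1 : ℤ) := fun p q => rfl
  -- the sweep
  obtain ⟨Sec, hcard, hsw⟩ := Summit.ValiantsHypothesis.ValiantsHypothesis.Theorems.TwoProducts.Sweep.stub_sweep D
  -- the sweep hypothesis of the sector cover
  have hSF : (∀ w : Fin 2 → ℤ, w 0 ≠ 0 → w 1 ≠ 0 → (∀ j, ∀ p ∈ (f j).support, ∀ q ∈ (f j).support, p ≠ q → ((w) 0 * ((p) 0 : ℤ) + (w) 1 * ((p) 1 : ℤ)) ≠ ((w) 0 * ((q) 0 : ℤ) + (w) 1 * ((q) 1 : ℤ))) → (∀ j, ∀ p ∈ (g j).support, ∀ q ∈ (g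
        j).support, p ≠ q → ((w) 0 * ((p) 0 : ℤ) + (w) 1 * ((p) 1 : ℤ)) ≠ ((w) 0 * ((q) 0 : ℤ) + (w) 1 * ((q) 1 : ℤ))) → ∃ rr ∈ Sec, rr.1 0 * rr.2 1 ≠ rr.1 1 * rr.2 0 ∧ ∃ a b K : ℤ, 0 < a ∧ 0 < b ∧ 0 < K ∧ K • w = a • rr.1 + b • rr.2 ∧ (∀
        j, ∀ p ∈ (f j).support, ∀ q ∈ (f j).support, ((w) 0 * ((p) 0 : ℤ) + (w) 1 * ((p) 1 : ℤ)) < ((w) 0 * ((q) 0 : ℤ) + (w) 1 * ((q) 1 : ℤ)) → ((rr.1) 0 * ((p) 0 : ℤ) + (rr.1) 1 * ((p) 1 : ℤ)) ≤ ((rr.1) 0 * ((q) 0 : ℤ) + (rr.1) 1 * ((q)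
        1 : ℤ)) ∧ ((rr.2) 0 * ((p) 0 : ℤ) + (rr.2) 1 * ((p) 1 : ℤ)) ≤ ((rr.2) 0 * ((q) 0 : ℤ) + (rr.2) 1 * ((q) 1 : ℤ))) ∧ (∀ j, ∀ p ∈ (g j).support, ∀ q ∈ (g j).support, ((w) 0 * ((p) 0 : ℤ) + (w) 1 * ((p) 1 : ℤ)) < ((w) 0 * ((q) 0 : ℤ) +
        (w) 1 * ((q) 1 : ℤ)) → ((rr.1) 0 * ((p) 0 : ℤ) + (rr.1) 1 * ((p) 1 : ℤ)) ≤ ((rr.1) 0 * ((q) 0 : ℤ) + (rr.1) 1 * ((q) 1 : ℤ)) ∧ ((rr.2) 0 * ((p) 0 : ℤ) + (rr.2) 1 * ((p) 1 : ℤ)) ≤ ((rr.2) 0 * ((q) 0 : ℤ) + (rr.2) 1 * ((q) 1 : ℤ))))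
        := by
    intro w hw0 hw1 hgenf hgeng
    have hDw : ∀ d ∈ D, w 0 * d 0 + w 1 * d 1 ≠ 0 := by
      intro d hd
      rw [hD] at hd
      simp only [Finset.mem_union, Finset.mem_biUnion, Finset.mem_univ, true_and,
        Finset.mem_image, Finset.mem_offDiag, Prod.exists] at hd
      rcases hd with ⟨j, p, q, ⟨hp, hq, hpq⟩, rfl⟩ | ⟨j, p, q, ⟨hp, hq, hpq⟩, rfl⟩
      · have := hgenf j p hp q hq hpq
        rw [Ne, ← sub_eq_zero, wt_sub] at this
        rwa [hdv0, hdv1]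
      · have := hgeng j p hp q hq hpq
        rw [Ne, ← sub_eq_zero, wt_sub] at this
        rwa [hdv0, hdv1]
    obtain ⟨rr, hrr, hdet, a, b, K, ha, hb, hK, hKw, hsign⟩ := hsw w hw0 hw1 hDw
    refine ⟨rr, hrr, hdet, a, b, K, ha, hb, hK, hKw, ?_, ?_⟩
    · intro j p hp q hq hlt
      have hpq : q ≠ p := fun h => by subst h; exact lt_irrefl _ hlt
      have hpos : 0 < w 0 * dv (q, p) 0 + w 1 * dv (q, p) 1 := by rw [hdv0, hdv1, ← wt_sub]; omega
      have h := hsign _ (hmemf j q p hq hp hpq) hpos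
      rw [hdv0, hdv1] at h
      have e1 := wt_sub rr.1 q p
      have e2 := wt_sub rr.2 q p
      constructor <;> omega
    · intro j p hp q hq hlt
      have hpq : q ≠ p := fun h => by subst h; exact lt_irrefl _ hlt
      have hpos : 0 < w 0 * dv (q, p) 0 + w 1 * dv (q, p) 1 := by rw [hdv0, hdv1, ← wt_sub]; omega
      have h := hsign _ (hmemg j q p hq hp hpq) hpos
      rw [hdv0, hdv1] at h
      have e1 := wt_sub rr.1 q p
      have e2 := wt_sub rr.2 q p
      constructor <;> omega
  have h := Summit.ValiantsHypothesis.ValiantsHypothesis.Theorems.TwoProducts.SectorCover.stub_sectorCover m t f g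
    hf hg hf0 hg0 Sec hSF (N + 2) (fun μ ν r₁ r₂ hA => sect_bound f g hf hg hloc μ ν r₁ r₂ hA)
  calc _ ≤ Sec.card * (N + 2) := h
    _ ≤ (4 * D.card + 4) * (N + 2) := Nat.mul_le_mul_right _ hcard
    _ ≤ (8 * m * t ^ 2 + 4) * (N + 2) := Nat.mul_le_mul_right _ (by
        calc 4 * D.card + 4 ≤ 4 * (2 * m * t ^ 2) + 4 := by omega
          _ = 8 * m * t ^ 2 + 4 := by ring)

/-- Doubling one factor: `∏_j (if j = j₀ then 2 else 1)·h_j = 2·∏_j h_j`. [folklore] -/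
theorem prod_double (h : Fin m → MvPolynomial (Fin 2) ℂ) (j₀ : Fin m) :
    (∏ j, (if j = j₀ then (MvPolynomial.C 2 : MvPolynomial (Fin 2) ℂ) else 1) * h j) =
      MvPolynomial.C 2 * ∏ j, h j := by
  rw [Finset.prod_mul_distrib, Finset.prod_ite_eq']
  simp

/-- Doubling does not change the support. [folklore] -/
theorem support_double (p : MvPolynomial (Fin 2) ℂ) :
    (MvPolynomial.C (2 : ℂ) * p).support = p.support := by
  rw [MvPolynomial.C_mul', MvPolynomial.support_smul_eq (two_ne_zero)]

/-- GENERAL FACTORS: `#vertSet(∏f − ∏g) ≤ (8mt² + 4)·(N + 2)` given a local bound `N` at sparsity `t`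
(zero factors are reduced to nonzero families by the doubling trick). [folklore] -/
theorem vertBound {N t : ℕ} (f g : Fin m → MvPolynomial (Fin 2) ℂ)
    (hf : ∀ j, (f j).support.card ≤ t) (hg : ∀ j, (g j).support.card ≤ t)
    (hloc : ∀ (u v : Fin m → MvPolynomial (Fin 2) ℂ),
      (∀ i, (u i).support.card ≤ t) → (∀ i, (v i).support.card ≤ t) →
      (∀ i, MvPolynomial.coeff 0 (u i) = 1) → (∀ i, MvPolynomial.coeff 0 (v i) = 1) →
      ({e : Fin 2 →₀ ℕ | ∃ w : Fin 2 → ℤ, 0 < w 0 ∧ 0 < w 1 ∧ ((e) ∈ ((∏ i, u i - ∏ i, v i).support) ∧ ∀ e' ∈ ((∏ i, u i - ∏ i, v i).support), e' ≠ (e) → ((w) 0 * ((e) 0 : ℤ) + (w) 1 * ((e) 1 : ℤ)) < ((w) 0 * ((e') 0 : ℤ) + (w) 1 * ((e') 1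
            : ℤ)))}).ncard ≤ N) :
    ({e : Fin 2 →₀ ℕ | ∃ w : Fin 2 → ℤ, ((e) ∈ ((∏ j, f j - ∏ j, g j).support) ∧ ∀ e' ∈ ((∏ j, f j - ∏ j, g j).support), e' ≠ (e) → ((w) 0 * ((e) 0 : ℤ) + (w) 1 * ((e) 1 : ℤ)) < ((w) 0 * ((e') 0 : ℤ) + (w) 1 * ((e') 1 : ℤ)))}).ncard ≤ (8 *
          m * t ^ 2 + 4) * (N + 2) := by
  -- the vertex set only depends on the support
  have hcongr : ∀ F G : MvPolynomial (Fin 2) ℂ, F.support = G.support → {e : Fin 2 →₀ ℕ | ∃ w : Fin 2 → ℤ, ((e) ∈ ((F).support) ∧ ∀ e' ∈ ((F).support), e' ≠ (e) → ((w) 0 * ((e) 0 : ℤ) + (w) 1 * ((e) 1 : ℤ)) < ((w) 0 * ((e') 0 : ℤ) + (w) 1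
        * ((e') 1 : ℤ)))} = {e : Fin 2 →₀ ℕ | ∃ w : Fin 2 → ℤ, ((e) ∈ ((G).support) ∧ ∀ e' ∈ ((G).support), e' ≠ (e) → ((w) 0 * ((e) 0 : ℤ) + (w) 1 * ((e) 1 : ℤ)) < ((w) 0 * ((e') 0 : ℤ) + (w) 1 * ((e') 1 : ℤ)))} := by
    intro F G hFG; simp only [hFG]
  by_cases hf0 : ∀ j, f j ≠ 0
  · by_cases hg0 : ∀ j, g j ≠ 0
    · exact vertBound_nonzero f g hf hg hf0 hg0 hloc
    · push Not at hg0
      obtain ⟨j₀, hj₀⟩ := hg0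
      have hpg : (∏ j, g j) = 0 := Finset.prod_eq_zero (Finset.mem_univ j₀) hj₀
      set f' : Fin m → MvPolynomial (Fin 2) ℂ :=
        fun j => (if j = j₀ then (MvPolynomial.C 2 : MvPolynomial (Fin 2) ℂ) else 1) * f j with hf'
      have hprod : (∏ j, f' j) - ∏ j, f j = (∏ j, f j) - ∏ j, g j := by
        rw [hpg, sub_zero, hf', prod_double, MvPolynomial.C_mul', two_smul, add_sub_cancel_right]
      have hsupp' : ∀ j, (f' j).support = (f j).support := by
        intro j; simp only [hf']
        split_ifs
        · exact support_double _
        · rw [one_mul]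
      have hf'0 : ∀ j, f' j ≠ 0 := by
        intro j h0
        have := hsupp' j
        rw [h0, MvPolynomial.support_zero] at this
        exact hf0 j (MvPolynomial.support_eq_empty.1 this.symm)
      have key := vertBound_nonzero f' f (fun j => by rw [hsupp' j]; exact hf j) hf hf'0 hf0 hloc
      rwa [hprod] at key
  · push Not at hf0
    obtain ⟨j₀, hj₀⟩ := hf0
    have hpf : (∏ j, f j) = 0 := Finset.prod_eq_zero (Finset.mem_univ j₀) hj₀
    by_cases hg0 : ∀ j, g j ≠ 0
    · set g' : Fin m → MvPolynomial (Fin 2) ℂ :=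
        fun j => (if j = j₀ then (MvPolynomial.C 2 : MvPolynomial (Fin 2) ℂ) else 1) * g j with hg'
      have hprod : (∏ j, g' j) - ∏ j, g j = ∏ j, g j := by
        rw [hg', prod_double, MvPolynomial.C_mul', two_smul, add_sub_cancel_right]
      have hsupp : ((∏ j, f j) - ∏ j, g j).support = ((∏ j, g' j) - ∏ j, g j).support := by
        rw [hprod, hpf, zero_sub, MvPolynomial.support_neg]
      have hsupp' : ∀ j, (g' j).support = (g j).support := by
        intro j; simp only [hg']
        split_ifs
        · exact support_double _
        · rw [one_mul]
      have hg'0 : ∀ j, g' j ≠ 0 := by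
        intro j h0
        have := hsupp' j
        rw [h0, MvPolynomial.support_zero] at this
        exact hg0 j (MvPolynomial.support_eq_empty.1 this.symm)
      have key := vertBound_nonzero g' g (fun j => by rw [hsupp' j]; exact hg j) hg hg'0 hg0 hloc
      rwa [hcongr _ _ hsupp]
    · push Not at hg0
      obtain ⟨j₁, hj₁⟩ := hg0
      have hpg : (∏ j, g j) = 0 := Finset.prod_eq_zero (Finset.mem_univ j₁) hj₁
      have h0 : {e : Fin 2 →₀ ℕ | ∃ w : Fin 2 → ℤ, ((e) ∈ ((∏ j, f j - ∏ j, g j).support) ∧ ∀ e' ∈ ((∏ j, f j - ∏ j, g j).support), e' ≠ (e) → ((w) 0 * ((e) 0 : ℤ) + (w) 1 * ((e) 1 : ℤ)) < ((w) 0 * ((e') 0 : ℤ) + (w) 1 * ((e') 1 : ℤ)))} =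
            ∅ := by
        rw [hpf, hpg, sub_zero]
        ext e
        simp
      rw [h0, Set.ncard_empty]
      exact Nat.zero_le _

/-! ## Exposure and arithmetic: the extreme-point count -/

/-- EXTREME POINTS ≤ COMBINATORIAL VERTICES (stub `stub_exposure`). [folklore] -/
theorem extreme_le_vert (F : MvPolynomial (Fin 2) ℂ) :
    (Set.extremePoints ℝ (convexHull ℝ ((fun e : Fin 2 →₀ ℕ => fun i : Fin 2 => ((e i : ℕ) : ℝ)) ''
      (F.support : Set (Fin 2 →₀ ℕ))))).ncard ≤ ({e : Fin 2 →₀ ℕ | ∃ w : Fin 2 → ℤ, ((e) ∈ ((F).support) ∧ ∀ e' ∈ ((F).support), e' ≠ (e) → ((w) 0 * ((e) 0 : ℤ) + (w) 1 * ((e) 1 : ℤ)) < ((w) 0 * ((e') 0 : ℤ) + (w) 1 * ((e') 1 :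
            ℤ)))}).ncard := by
  have hfin : ({e : Fin 2 →₀ ℕ | ∃ w : Fin 2 → ℤ, ((e) ∈ ((F).support) ∧ ∀ e' ∈ ((F).support), e' ≠ (e) → ((w) 0 * ((e) 0 : ℤ) + (w) 1 * ((e) 1 : ℤ)) < ((w) 0 * ((e') 0 : ℤ) + (w) 1 * ((e') 1 : ℤ)))}).Finite := by
    refine Set.Finite.subset (Finset.finite_toSet F.support) ?_
    rintro e ⟨w, he, -⟩
    exact Finset.mem_coe.2 he
  have hcover : Set.extremePoints ℝ (convexHull ℝ ((fun e : Fin 2 →₀ ℕ => fun i : Fin 2 =>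
      ((e i : ℕ) : ℝ)) '' (F.support : Set (Fin 2 →₀ ℕ)))) ⊆
      (fun e : Fin 2 →₀ ℕ => fun i : Fin 2 => ((e i : ℕ) : ℝ)) '' {e : Fin 2 →₀ ℕ | ∃ w : Fin 2 → ℤ, ((e) ∈ ((F).support) ∧ ∀ e' ∈ ((F).support), e' ≠ (e) → ((w) 0 * ((e) 0 : ℤ) + (w) 1 * ((e) 1 : ℤ)) < ((w) 0 * ((e') 0 : ℤ) + (w) 1 *
            ((e') 1 : ℤ)))} := by
    intro p hp
    obtain ⟨e, hep, w, hw⟩ :=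
      Summit.ValiantsHypothesis.ValiantsHypothesis.Theorems.TwoProducts.Exposure.stub_exposure F.support p hp
    exact ⟨e, ⟨w, hw⟩, hep⟩
  exact (Set.ncard_le_ncard hcover (hfin.image _)).trans (Set.ncard_image_le hfin)

/-- The final arithmetic: `(8mt² + 4)·(2^((a+1)m)(t+2)^b + 2) ≤ 2^((a+2)m)·(t+2)^(b+8)`. [folklore] -/
theorem bound_arith (a b m t : ℕ) :
    (8 * m * t ^ 2 + 4) * (2 ^ ((a + 1) * m) * (t + 2) ^ b + 2) ≤ 2 ^ ((a + 2) * m) * (t + 2) ^ (b + 8) := by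
  set X : ℕ := 2 ^ ((a + 1) * m) * (t + 2) ^ b with hX
  have hX1 : 1 ≤ X := Nat.one_le_iff_ne_zero.2 (by positivity)
  have hm : m ≤ 2 ^ m := Nat.lt_two_pow_self.le
  have h12 : 1 ≤ 2 ^ m := Nat.one_le_two_pow
  have ht : t ^ 2 ≤ (t + 2) ^ 2 := Nat.pow_le_pow_left (by omega) 2
  have h4 : 4 ≤ (t + 2) ^ 2 := by
    calc 4 = 2 ^ 2 := by norm_num
      _ ≤ (t + 2) ^ 2 := Nat.pow_le_pow_left (by omega) 2
  have hA : 8 * m * t ^ 2 + 4 ≤ 16 * (2 ^ m * (t + 2) ^ 2) := by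
    have e1 : 8 * m * t ^ 2 ≤ 8 * (2 ^ m * (t + 2) ^ 2) := by
      calc 8 * m * t ^ 2 = 8 * (m * t ^ 2) := by ring
        _ ≤ 8 * (2 ^ m * (t + 2) ^ 2) := by gcongr
    have e2 : 4 ≤ 8 * (2 ^ m * (t + 2) ^ 2) := by
      calc 4 ≤ 1 * 4 := by norm_num
        _ ≤ 2 ^ m * (t + 2) ^ 2 := Nat.mul_le_mul h12 h4
        _ ≤ 8 * (2 ^ m * (t + 2) ^ 2) := by omega
    omega
  have hB : X + 2 ≤ 4 * X := by omega
  have h64 : 64 ≤ (t + 2) ^ 6 := by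
    calc 64 = 2 ^ 6 := by norm_num
      _ ≤ (t + 2) ^ 6 := Nat.pow_le_pow_left (by omega) 6
  calc (8 * m * t ^ 2 + 4) * (X + 2) ≤ (16 * (2 ^ m * (t + 2) ^ 2)) * (4 * X) := Nat.mul_le_mul hA hB
    _ = 64 * (2 ^ m * X) * (t + 2) ^ 2 := by ring
    _ ≤ (t + 2) ^ 6 * (2 ^ m * X) * (t + 2) ^ 2 := by gcongr
    _ = 2 ^ ((a + 2) * m) * (t + 2) ^ (b + 8) := by rw [hX]; ring

/-- **The crux from the engine.**  The LOG-SUM NEWTON BOUND (registered stub `stub_logSumNewton` of the line, its only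
open statement; equivalent to the crux up to the polynomial factor of the reduction) implies `TwoProducts`, with
`(A, B) = (a + 2, b + 8)`. [folklore] -/
theorem twoProducts_of_logSumNewton :
    (∃ a b : ℕ, ∀ (n t : ℕ) (u v : Fin n → MvPolynomial (Fin 2) ℂ), 3 ≤ t →
      (∀ i, (u i).support.card ≤ t) → (∀ i, (v i).support.card ≤ t) →
      (∀ i, MvPolynomial.coeff 0 (u i) = 1) → (∀ i, MvPolynomial.coeff 0 (v i) = 1) →
      ({e : Fin 2 →₀ ℕ | ∃ w : Fin 2 → ℤ, 0 < w 0 ∧ 0 < w 1 ∧ ∀ R : ℕ, ((w) 0 * ((e) 0 : ℤ) + (w) 1 * ((e) 1 : ℤ)) < (R : ℤ) → ((e) ∈ ((∑ r ∈ Finset.Icc 1 R, ((-1 : ℂ) ^ (r + 1) / (r : ℂ)) • (∑ i, (u i - 1) ^ r - ∑ i, (v i - 1) ^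
            r)).support) ∧ ∀ e' ∈ ((∑ r ∈ Finset.Icc 1 R, ((-1 : ℂ) ^ (r + 1) / (r : ℂ)) • (∑ i, (u i - 1) ^ r - ∑ i, (v i - 1) ^ r)).support), e' ≠ (e) → ((w) 0 * ((e) 0 : ℤ) + (w) 1 * ((e) 1 : ℤ)) < ((w) 0 * ((e') 0 : ℤ) + (w) 1 * ((e')
            1 : ℤ)))}).ncard ≤ 2 ^ (a * n) * (t + 2) ^ b) →
    Summit.ValiantsHypothesis.ValiantsHypothesis.Theses.NewtonUnitEquations.TwoProducts := by
  rintro ⟨a, b, hLog⟩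
  refine ⟨a + 2, b + 8, ?_⟩
  intro m t f g hf hg
  have hvert := vertBound (N := 2 ^ ((a + 1) * m) * (t + 2) ^ b) f g hf hg
    (fun u v hu hv hu1 hv1 => local_bound_of_logSum hLog u v hu hv hu1 hv1)
  exact ((extreme_le_vert _).trans hvert).trans (bound_arith a b m t)

/-- **The binomial case of `TwoProducts`, unconditionally and POLYNOMIALLY in `m` (any number of factors, all
regimes).**  If every `f j`, `g j` has at most `t ≤ 2` monomials then `Newt(∏ f − ∏ g)` has at most `72·(m+1)²`
vertices: `≤ 8mt² + 4 ≤ 32m + 4` sectors, each showing `≤ 2m + 2` vertices by the ray-series rung.  (Disproof.lean §3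
F3 states `8m² + O(m)` with the sharp sector count; no common-exponent or distinct-subset-sum hypothesis is needed, so
this contains route item `BinomialPencil`, stmt-ValiantsHypothesis-5908, with `C = 72`.) [folklore] -/
theorem twoProducts_sparsity_le_two : ∀ (m t : ℕ) (f g : Fin m → MvPolynomial (Fin 2) ℂ), t ≤ 2 →
    (∀ j, (f j).support.card ≤ t) → (∀ j, (g j).support.card ≤ t) →
    (Set.extremePoints ℝ (convexHull ℝ ((fun e : Fin 2 →₀ ℕ => fun i : Fin 2 => ((e i : ℕ) : ℝ)) ''
      ((∏ j, f j - ∏ j, g j).support : Set (Fin 2 →₀ ℕ))))).ncard ≤ 72 * (m + 1) ^ 2 := by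
  intro m t f g ht hf hg
  have hvert := vertBound (N := 2 * m) f g hf hg (fun u v hu hv hu1 hv1 => local_bound_two ht u v hu hv hu1 hv1)
  have ht2 : t ^ 2 ≤ 4 := by
    calc t ^ 2 ≤ 2 ^ 2 := Nat.pow_le_pow_left ht 2
      _ = 4 := by norm_num
  calc _ ≤ (8 * m * t ^ 2 + 4) * (2 * m + 2) := (extreme_le_vert _).trans hvert
    _ ≤ (8 * m * 4 + 4) * (2 * m + 2) := by gcongr
    _ ≤ 72 * (m + 1) ^ 2 := by nlinarith

end

end Summit.ValiantsHypothesis.ValiantsHypothesis.Theorems.TwoProducts.Reduction
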